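import Summits.PneNP.PneNP.Theses.Proofcplx

/-!
# Route Proofcplx — `Assembly` (stmt-PneNP-10744)

`Assembly := ProofcplxThesis → PneNP` is literally the type of the route's deciding theorem
`Summit.PneNP.PneNP.Theses.Proofcplx.closes` (proved in the route file: under `P = NP`,
`coNP = co P = P = NP`, Arora–Barak 2009 §2.6.1). This file imports only the route file.
-/

set_option linter.dupNamespace false -- `Summit.PneNP.PneNP.…`: summit = sub-problem name (D-0017 single-conjunct layout)

namespace Summit.PneNP.PneNP.Theorems

/-- **Assembly item of route Proofcplx (stmt-PneNP-10744)**: `ProofcplxThesis → PneNP`, by the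
route's deciding theorem `Proofcplx.closes`. [cite: AroraBarakCC2009, §2.6.1] [cite: CookReckhow1979, §1 Prop. 1.1] -/
theorem proofcplx_assembly_rev_proof : Summit.PneNP.PneNP.Theses.Proofcplx.Assembly := by
  unfold Summit.PneNP.PneNP.Theses.Proofcplx.Assembly
  exact fun hX => Summit.PneNP.PneNP.Theses.Proofcplx.closes hX

end Summit.PneNP.PneNP.Theorems
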